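import Literature.MathematicalPhysics.QuantumLattice.HubbardTPPObjectMCapBoxWords
import HarnessLib

/-!
# Object-M words on `(U, t', t'', n)` boxes, constant shape: the two-sided word from an S2 floor word and a
# constant exact cap, its decimal enclosure, and the hole-doped allowance radius

Topic `MathematicalPhysics/QuantumLattice`, family `hubbard`. Companion of `HubbardTPPObjectMCapBoxWords`
(affine shape). The material-oracle seam consumes CONSTANT words `L ≤ e^M ≤ R` on a typed box; this file
states them directly: `tpp_word_box₄_of_floor_Icc₃_of_constCap` (floor transported along `t''` by the
kinematic class bound `(16/π²)·max(|r₁|, |r₂|)`, cap a constant certified on the 4-box),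
`kinematicAllowance_le_decimal` (`16/π² ≤ 1.6212`), `tpp_word_box₄_const_decimal`, and the radius
simplification `max |r₁| |r₂| = r₂` for `0 ≤ r₁ ≤ r₂` (cuprates: `t'' > 0`). Everything is proved; no
definition, nothing numerical.

## References

* R. B. Israel, *Convexity in the Theory of Lattice Gases* (1979), Thm. I.3.4. [cite: Israel1979, Thm. I.3.4]
* D. Ruelle, *Statistical Mechanics: Rigorous Results* (1969), §3.4. [cite: Ruelle1969, §3.4]
-/

namespace Literature.MathematicalPhysics.QuantumLattice

open Set ThermodynamicLimit

/-- **`16/π² ≤ 1.6212`** times a nonnegative radius (`π > 3.141592`): the decimal form of the kinematic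
`t''` allowance. [cite: Israel1979, Thm. I.3.4] -/
theorem kinematicAllowance_le_decimal (m : ℝ) (hm : 0 ≤ m) : 16 / Real.pi ^ 2 * m ≤ 1.6212 * m := by
  refine mul_le_mul_of_nonneg_right ?_ hm
  have hπ : (3.141592 : ℝ) < Real.pi := Real.pi_gt_d6
  have hπ2 : (3.141592 : ℝ) ^ 2 < Real.pi ^ 2 := by
    exact pow_lt_pow_left₀ hπ (by norm_num) (by norm_num)
  rw [div_le_iff₀ (by positivity)]
  nlinarith

/-- For `0 ≤ r₁ ≤ r₂` the allowance radius is `max |r₁| |r₂| = r₂`. [folklore] -/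
private theorem max_abs_eq_right {r₁ r₂ : ℝ} (h₁ : 0 ≤ r₁) (h₂ : r₁ ≤ r₂) : max |r₁| |r₂| = r₂ := by
  rw [abs_of_nonneg h₁, abs_of_nonneg (h₁.trans h₂), max_eq_right h₂]

/-- **THE TWO-SIDED OBJECT-M WORD, constant shape.** An S2 floor word `F ≤ e(1, s, u, n)` on the
`(U, t', n)` projection `Set.Icc ![U₁, s₁, n₁] ![U₂, s₂, n₂]` (`U₁ ≥ 0`, `0 < n₁`, `n₂ < 2`) and a constant cap
`e^M ≤ C` certified on the 4-box give, at every point of `[U₁, U₂] × [s₁, s₂] × [r₁, r₂] × [n₁, n₂]`,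
`F − (16/π²)·max(|r₁|, |r₂|) ≤ e^M(1, s, r, u; n) ≤ C`. [cite: Israel1979, Thm. I.3.4] [cite: Ruelle1969, §3.4] -/
theorem tpp_word_box₄_of_floor_Icc₃_of_constCap {U₁ U₂ s₁ s₂ r₁ r₂ n₁ n₂ F C : ℝ}
    (hU₁ : 0 ≤ U₁) (hn0 : 0 < n₁) (hn2 : n₂ < 2)
    (hF : ∀ θ ∈ Set.Icc (![U₁, s₁, n₁] : Fin 3 → ℝ) ![U₂, s₂, n₂], F ≤ energyDensityTT' 1 (θ 1) (θ 0) (θ 2))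
    (hC : ∀ u s r n : ℝ, U₁ ≤ u → u ≤ U₂ → s₁ ≤ s → s ≤ s₂ → r₁ ≤ r → r ≤ r₂ → n₁ ≤ n → n ≤ n₂ →
      (hubbardTT'T''FermionInteraction 1 s r u).tiGroundEnergyDensityAt 2 n ≤ C) :
    ∀ u s r n : ℝ, U₁ ≤ u → u ≤ U₂ → s₁ ≤ s → s ≤ s₂ → r₁ ≤ r → r ≤ r₂ → n₁ ≤ n → n ≤ n₂ →
      F - 16 / Real.pi ^ 2 * max |r₁| |r₂| ≤ (hubbardTT'T''FermionInteraction 1 s r u).tiGroundEnergyDensityAt 2 n ∧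
        (hubbardTT'T''FermionInteraction 1 s r u).tiGroundEnergyDensityAt 2 n ≤ C := by
  intro u s r n hu₁ hu₂ hs₁ hs₂ hr₁ hr₂ hm₁ hm₂
  have h := tpp_word_box₄_of_floor_Icc₃_of_cap (H₀ := C) (H₁ := 0) (H₂ := 0) (H₃ := 0) (H₄ := 0) hU₁ hn0 hn2 hF
    (fun u s r n h1 h2 h3 h4 h5 h6 h7 h8 => by simpa using hC u s r n h1 h2 h3 h4 h5 h6 h7 h8)
    u s r n hu₁ hu₂ hs₁ hs₂ hr₁ hr₂ hm₁ hm₂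
  simpa using h

/-- **Decimal form, constant shape**: with `L ≤ F − 1.6212·max(|r₁|, |r₂|)` the word reads `L ≤ e^M ≤ C` on the
4-box. [cite: Israel1979, Thm. I.3.4] -/
theorem tpp_word_box₄_const_decimal {U₁ U₂ s₁ s₂ r₁ r₂ n₁ n₂ F C L : ℝ}
    (hU₁ : 0 ≤ U₁) (hn0 : 0 < n₁) (hn2 : n₂ < 2)
    (hF : ∀ θ ∈ Set.Icc (![U₁, s₁, n₁] : Fin 3 → ℝ) ![U₂, s₂, n₂], F ≤ energyDensityTT' 1 (θ 1) (θ 0) (θ 2))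
    (hC : ∀ u s r n : ℝ, U₁ ≤ u → u ≤ U₂ → s₁ ≤ s → s ≤ s₂ → r₁ ≤ r → r ≤ r₂ → n₁ ≤ n → n ≤ n₂ →
      (hubbardTT'T''FermionInteraction 1 s r u).tiGroundEnergyDensityAt 2 n ≤ C)
    (hL : L ≤ F - 1.6212 * max |r₁| |r₂|) :
    ∀ u s r n : ℝ, U₁ ≤ u → u ≤ U₂ → s₁ ≤ s → s ≤ s₂ → r₁ ≤ r → r ≤ r₂ → n₁ ≤ n → n ≤ n₂ →
      L ≤ (hubbardTT'T''FermionInteraction 1 s r u).tiGroundEnergyDensityAt 2 n ∧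
        (hubbardTT'T''FermionInteraction 1 s r u).tiGroundEnergyDensityAt 2 n ≤ C := by
  intro u s r n hu₁ hu₂ hs₁ hs₂ hr₁ hr₂ hm₁ hm₂
  have h := tpp_word_box₄_of_floor_Icc₃_of_constCap hU₁ hn0 hn2 hF hC u s r n hu₁ hu₂ hs₁ hs₂ hr₁ hr₂ hm₁ hm₂
  have ha := kinematicAllowance_le_decimal (max |r₁| |r₂|) (le_trans (abs_nonneg r₁) (le_max_left _ _))
  exact ⟨by linarith [h.1], h.2⟩

/-- **Hole-doped form** (`0 ≤ r₁ ≤ r₂`, i.e. `t'' ≥ 0` on the box): the allowance radius is `r₂`, so the word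
reads `F − (16/π²) r₂ ≤ e^M ≤ C`; with `L ≤ F − 1.6212 r₂` it reads `L ≤ e^M ≤ C`. [cite: Israel1979, Thm. I.3.4] -/
theorem tpp_word_box₄_const_decimal_pos {U₁ U₂ s₁ s₂ r₁ r₂ n₁ n₂ F C L : ℝ}
    (hU₁ : 0 ≤ U₁) (hn0 : 0 < n₁) (hn2 : n₂ < 2) (hr₀ : 0 ≤ r₁) (hr : r₁ ≤ r₂)
    (hF : ∀ θ ∈ Set.Icc (![U₁, s₁, n₁] : Fin 3 → ℝ) ![U₂, s₂, n₂], F ≤ energyDensityTT' 1 (θ 1) (θ 0) (θ 2))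
    (hC : ∀ u s r n : ℝ, U₁ ≤ u → u ≤ U₂ → s₁ ≤ s → s ≤ s₂ → r₁ ≤ r → r ≤ r₂ → n₁ ≤ n → n ≤ n₂ →
      (hubbardTT'T''FermionInteraction 1 s r u).tiGroundEnergyDensityAt 2 n ≤ C)
    (hL : L ≤ F - 1.6212 * r₂) :
    ∀ u s r n : ℝ, U₁ ≤ u → u ≤ U₂ → s₁ ≤ s → s ≤ s₂ → r₁ ≤ r → r ≤ r₂ → n₁ ≤ n → n ≤ n₂ →
      L ≤ (hubbardTT'T''FermionInteraction 1 s r u).tiGroundEnergyDensityAt 2 n ∧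
        (hubbardTT'T''FermionInteraction 1 s r u).tiGroundEnergyDensityAt 2 n ≤ C := by
  have hmax : max |r₁| |r₂| = r₂ := max_abs_eq_right hr₀ hr
  refine tpp_word_box₄_const_decimal hU₁ hn0 hn2 hF hC ?_
  rw [hmax]
  exact hL

end Literature.MathematicalPhysics.QuantumLattice
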